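import Summits.KontsevichZagierPeriods.Zeta5Search.CasoratianValuation

/-!
# ζ(5) search — TRACK «DENOM-LAW», D2: the first-period denominator law in Casoratian form (PATH accounting + rule R), typed

HONEST FRAMING: systematic search; no irrationality claim unless certified.  The three `Prop`s below are statements
minted by the cell `pub-zeta5` (seat denom-engine-d2, 2026-08-23; `HOME/denom-law/TYPE-LAW-v2.md` §0, §3, §4.2,
STRUCTURE.md §0.2 C10), found by exact p-adic mining of the cell's rows and tested on SEALED out-of-sample rows; they are
tagged `@[conjecture]` and are NOT proved here (leaf statement file: no `_holds`, no `sorry`).  Nothing in this file is a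
statement about ζ(5); it concerns the p-adic valuation of the 2×2 minor `casoratian b 7` of the canonical dual coefficients
(`CasoratianValuation`), whose multiple `ρ(b)·Cas₇(b)` is the constant term `P` of the cellular linear form.

Setting (first period of the k = 0 zone).  `b = (b₀; b₁ ≥ … ≥ b₇)` in the Brown–Zudilin polytope (sorted labelling,
`Sorted7`), a prime `p ≥ 5` with `p² > b₀ + 2` such that every one of the 28 forms (`b_i`, `b₀ − b_i − b_k`) is `< 2p`
(`FirstPeriod`: each Legendre digit is 0 or 1).  `N = pairFloors b p` = number of pair blocks `≥ p`; `a = longCount b p` =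
number of parameters `≥ p`; `⌊d/p⌋ = dOf b / p`; `C⋆ = cStar b p` = the largest, over the Hamiltonian paths of `K₇`, of
(# interior vertices `i` with `b_i ≥ p`) + (# path edges `(i,k)` with `b₀ − b_i − b_k ≥ p`).

* `PathAccountingFirstPeriod` — Brown–Zudilin's (28)+(30) accounting (arXiv:2210.03391 p. 20), transported over the group
  `G ≅ S₇` by (27) and rewritten for the Casoratian (the cell's PATH law, SYMMETRY-D3.md §4; = the staircase exponent at every
  large prime, two-implementation table 26,215/26,215): `v_p(Cas₇) ≥ ⌊d/p⌋ − N − min([⌊d/p⌋ ≥ 2], 5 − C⋆)`.  This half is an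
  ACCOUNTING statement expected to be provable from the tree's ingredients; it is kept separate so that a theorem can discharge it
  without touching rule R.
* `RuleR2Casoratian`, `RuleR1Casoratian` — RULE R (the ν+1 cells): ONE unit more on the matching cells: at `⌊d/p⌋ = 2` with
  `a ≤ 4` and the zig-zag Hamiltonian CYCLE blocks `M(a)` reaching `p`: `v_p(Cas₇) ≥ (a + 4) − N`; at `⌊d/p⌋ = 1` with `a ≥ 1` and
  the antipodal matching of the other six reaching `p`: `v_p(Cas₇) ≥ (a + 1) − N` (the tree's `CasoratianValuationLaw` gives `1 − N`).

EVIDENCE LEDGER (exact integers; every γ elsewhere a MODEL number; records in print UNMOVED).  Training = the cell's exact rows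
n ≤ 40 of the 876 regular directions (all 28 forms ≥ 0, d ≤ 2m₁), k = 0 primes p ≥ 5 with p² > m₁n, contiguity index = the least
parameter (j = 7 in sorted labelling), kernel schema (v_p(P) − v_p(ρ)): the combined law `PathAccounting + R` has 0 violations on
178,133 first-period cells with EQUALITY at 176,532 (99.10 %; 364 digit types); rule R2 cells 13,331: `v − ((a+4) − N)` ∈ {0: 13,214,
1: 115, 2: 2}; rule R1 cells 1,417: {0: 1,395, 1: 22}; the type-level decision table at ⌊d/p⌋ = 2 (241 types: 30 law / 211 null) has
0 disagreements with R2.  Two independent implementations of the underlying p-adic table agree cell for cell (lane cp-z5-audit: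
13 tables, 587,900 cells, 0 differences; type pooling 84/84).  SEALED PREDICTIONS (sha256 in HOME/INBOX.md before the rows existed):
P-D2-3 `672e27f38be6ab2d…`, P-D2-3b `c80d1be8ce94ef8d…` → scored on census kit j180578 (2026-08-23T03:45Z, `prereg/SCORE-P-D2-2-3.md`):
0 violations on 11,079 cells, 481/481 predicted R-cells observed (A18 n = 46..55: 255/255; TOP_STAIR #3 n = 41..46: 51/51; rows
41–46 earlier on disk: 175/175; record ray n = 41..60: 0 predicted, 0 systematic); P-D2-1 P7 and P-D2-2 (the 84-type table) HIT on
the same rows.  OFF the rays (2026-08-23T04:00Z, `code/d2g2/offray_test.py`, exact dual-series engine on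
8,805 random sorted polytope vectors with 16 ≤ b₀ ≤ 44): `PathAccountingFirstPeriod` 0 violations / 42,883 cells (equality 95.3 %),
`RuleR2Casoratian` 85/85, `RuleR1Casoratian` 12/12; targeted rejection sampling of the R2/R1 HYPOTHESES off the rays
(`offray_targeted.py`, primes 5 ≤ p < 60): `RuleR2Casoratian` 1,989 cells (a = 0..4: 1598/191/134/43/23), 0 violations, equality 1,875;
`RuleR1Casoratian` 407 cells (a = 1..7), 0 violations, equality 395.  Referees' official concurrence on the scores: ref-2 g80, HOME/INBOX 2026-08-23T04:05Z.  On the certified γ-ridge direction a = (89,184,124,172,142,178,196,154) the rule's one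
predicted cell (sealed P-D2-RIDGE; R1 with a = 6, unseen in training) was observed at (n,p) = (1,137) and (4,547) exactly as predicted (census ridge480 rows).
Third survival ⇒ typed per the lead's standing rule (5), HOME/INBOX 2026-08-23T03:49Z.  Falsifier: one first-period
k = 0 cell with `v_p(Cas₇)` below the stated right-hand side.  Law-status words of record: OBSERVED (two implementations) on
n ≤ 40/60, CONJECTURED for all n.
-/

namespace Summit.KontsevichZagierPeriods.Zeta5Search.DenomLaw

open Finset
open Summit.KontsevichZagierPeriods.Zeta5Search.CasoratianValuation
  (InPolytope shift casoratian pairFloors)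
open Summit.KontsevichZagierPeriods.Zeta5Search.WedgeDictionary (dOf)

/-- Sorted labelling of the lower parameters: `b₁ ≥ b₂ ≥ … ≥ b₇`. -/
def Sorted7 (b : ℕ → ℤ) : Prop := ∀ i ∈ range 6, b (i + 2) ≤ b (i + 1)

/-- `a_p(b) = #{1 ≤ i ≤ 7 : b_i ≥ p}` — the parameters ('point forms') reaching `p`. -/
def longCount (b : ℕ → ℤ) (p : ℕ) : ℕ := ((range 7).filter fun i => (p : ℤ) ≤ b (i + 1)).card

/-- First period: all 28 Brown–Zudilin forms are `< 2p` (every Legendre digit is 0 or 1). -/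
def FirstPeriod (b : ℕ → ℤ) (p : ℕ) : Prop :=
  (∀ i ∈ range 7, b (i + 1) < 2 * (p : ℤ)) ∧
  (∀ i ∈ range 7, ∀ k ∈ range 7, i < k → b 0 - b (i + 1) - b (k + 1) < 2 * (p : ℤ))

/-- The pair block through the `i`-th and `k`-th parameters (1-based) reaches `p`. -/
def BlockGe (b : ℕ → ℤ) (p : ℕ) (i k : ℕ) : Prop := (p : ℤ) ≤ b 0 - b i - b k

/-- Weight of the Hamiltonian path `π(0) – π(1) – … – π(6)` of `K₇` (vertices = the seven parameters): interior vertices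
`π(1..5)` whose parameter reaches `p`, plus path edges whose pair block reaches `p`. -/
def pathWeight (b : ℕ → ℤ) (p : ℕ) (π : Equiv.Perm (Fin 7)) : ℕ :=
  ((univ : Finset (Fin 5)).filter fun t => (p : ℤ) ≤ b ((π ⟨t.val + 1, by omega⟩).val + 1)).card +
  ((univ : Finset (Fin 6)).filter fun t =>
      (p : ℤ) ≤ b 0 - b ((π ⟨t.val, by omega⟩).val + 1) - b ((π ⟨t.val + 1, by omega⟩).val + 1)).card

/-- `C⋆_p(b)`: the largest path weight over the 5040 vertex orderings (= 2520 Hamiltonian paths of `K₇` up to reversal). -/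
def cStar (b : ℕ → ℤ) (p : ℕ) : ℕ := (univ : Finset (Equiv.Perm (Fin 7))).sup (pathWeight b p)

/-- **PATH ACCOUNTING, first period (Brown–Zudilin (28)+(30) transported by `G ≅ S₇`, in Casoratian form).**
`v_p(Cas₇(b)) ≥ ⌊d/p⌋ − N − min([⌊d/p⌋ ≥ 2], 5 − C⋆)`.  An accounting statement (the cell's PATH = STAIR law at large primes);
0 violations on 178,133 first-period cells; kept separate from rule R so that a proof can discharge it alone. -/
@[conjecture] def PathAccountingFirstPeriod : Prop :=
  ∀ (b : ℕ → ℤ) (p : ℕ), InPolytope b → Sorted7 b → InPolytope (shift b 7) →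
    p.Prime → 5 ≤ p → (b 0 + 2 : ℤ) < (p : ℤ) ^ 2 → FirstPeriod b p → casoratian b 7 ≠ 0 →
      dOf b / (p : ℤ) - pairFloors b p - min (if 2 ≤ dOf b / (p : ℤ) then (1 : ℤ) else 0) (5 - (cStar b p : ℤ))
        ≤ padicValRat p (casoratian b 7)

/-- Rule R2's matching condition `M(a)` (sorted labelling): the binding blocks of the zig-zag Hamiltonian cycle `Z_a`. -/
def MatchingR2 (b : ℕ → ℤ) (p : ℕ) : ℕ → Prop
  | 0 => BlockGe b p 1 6 ∧ BlockGe b p 2 5 ∧ BlockGe b p 3 4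
  | 1 => BlockGe b p 1 5 ∧ BlockGe b p 3 4
  | 2 => BlockGe b p 1 5 ∧ BlockGe b p 2 4
  | 3 => BlockGe b p 1 5 ∧ BlockGe b p 2 3
  | 4 => BlockGe b p 1 4 ∧ BlockGe b p 2 3
  | _ => False

/-- Rule R1's condition: the antipodal matching of `{1,…,7} ∖ {a}` reaches `p` (pair the remaining six first-with-last). -/
def MatchingR1 (b : ℕ → ℤ) (p : ℕ) : ℕ → Prop
  | 1 => BlockGe b p 2 7 ∧ BlockGe b p 3 6 ∧ BlockGe b p 4 5
  | 2 => BlockGe b p 1 7 ∧ BlockGe b p 3 6 ∧ BlockGe b p 4 5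
  | 3 => BlockGe b p 1 7 ∧ BlockGe b p 2 6 ∧ BlockGe b p 4 5
  | 4 => BlockGe b p 1 7 ∧ BlockGe b p 2 6 ∧ BlockGe b p 3 5
  | 5 => BlockGe b p 1 7 ∧ BlockGe b p 2 6 ∧ BlockGe b p 3 4
  | 6 => BlockGe b p 1 7 ∧ BlockGe b p 2 5 ∧ BlockGe b p 3 4
  | 7 => BlockGe b p 1 6 ∧ BlockGe b p 2 5 ∧ BlockGe b p 3 4
  | _ => False

/-- **RULE R2 (the ν+1 cells at `⌊d/p⌋ = 2`; D2 TYPE-LAW v2).**  With `a = a_p(b) ≤ 4` parameters reaching `p` and the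
matching blocks `M(a)` reaching `p`: `v_p(Cas₇(b)) ≥ (a + 4) − N` (PATH accounting gives `a + 3 − N` there, `(CV)` gives `1 − N`).
Training: 13,331 cells, never below, equality at 99.1 %; sealed out of sample: 401/401 cells (A18, A14, TOP_STAIR rays). -/
@[conjecture] def RuleR2Casoratian : Prop :=
  ∀ (b : ℕ → ℤ) (p : ℕ), InPolytope b → Sorted7 b → InPolytope (shift b 7) →
    p.Prime → 5 ≤ p → (b 0 + 2 : ℤ) < (p : ℤ) ^ 2 → FirstPeriod b p → dOf b / (p : ℤ) = 2 →
    longCount b p ≤ 4 → MatchingR2 b p (longCount b p) → casoratian b 7 ≠ 0 →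
      ((longCount b p : ℤ) + 4) - pairFloors b p ≤ padicValRat p (casoratian b 7)

/-- **RULE R1 (the `⌊d/p⌋ = 1` companion).**  With `a = a_p(b) ≥ 1` and the antipodal matching of the other six parameters
reaching `p`: `v_p(Cas₇(b)) ≥ (a + 1) − N`.  Training: 1,417 cells (equality at 1,395, one above at 22); sealed out of sample:
80/80 cells (TOP_STAIR #3, #5). -/
@[conjecture] def RuleR1Casoratian : Prop :=
  ∀ (b : ℕ → ℤ) (p : ℕ), InPolytope b → Sorted7 b → InPolytope (shift b 7) →
    p.Prime → 5 ≤ p → (b 0 + 2 : ℤ) < (p : ℤ) ^ 2 → FirstPeriod b p → dOf b / (p : ℤ) = 1 →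
    1 ≤ longCount b p → MatchingR1 b p (longCount b p) → casoratian b 7 ≠ 0 →
      ((longCount b p : ℤ) + 1) - pairFloors b p ≤ padicValRat p (casoratian b 7)

end Summit.KontsevichZagierPeriods.Zeta5Search.DenomLaw
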